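import Literature.AlgebraicGeometry.Resolution.BlowupStalkCharts
import Literature.AlgebraicGeometry.Resolution.GermsOfClosedSubsets
import Literature.AlgebraicGeometry.Resolution.GenericPointStalkData

/-!
# SplitTower (S-1/5, scheme plumbing) — THE CHART FAMILY OF A BLOWING UP OVER `Spec 𝒪_{X,s}` and the primes of
its points

Node «SplitTower» of `decomp-res-lens-2` (g34), see `Theorems/MaxContactCutSplitTower.lean`.

For a blowing up `π : X' → X` along `J`, a point `s ∈ X` and generators `c` of `J_s`, the base change
`X' ×_X Spec 𝒪_{X,s} ≅ Proj 𝒪_{X,s}[J_s t]` is covered by the charts `Spec B_j`, `B_j = 𝒪_{X,s}[J_s/c_j]`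
(`chartRing c j`); composed with the pro-open immersion to `X'` these are the morphisms `q_j : Spec B_j → X'` of a
CHART FAMILY (`ChartFamily`, `ChartFamily.nonempty`): they lie over `Spec B_j → Spec 𝒪_{X,s} → X`, induce
isomorphisms on all local rings, cover every point `x'` with `π x' ⤳ s` (not only the fibre), and — the one
genuinely new item — SPECIALIZATIONS LIFT: `q_{j'} p ⤳ q_j w` forces `q_{j'} p = q_j p₁` with `p₁ ⤳ w` IN THE
SAME CHART (`X' ×_X Spec 𝒪_{X,s} → X'` is a topological embedding, the charts are open).  The dictionary at a chart
point `w` (`ChartFamily.χ`): `χ_w : B_j → 𝒪_{X', q_j w}` presents the local ring as `(B_j)_w`, restricted to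
`𝒪_{X,s}` it is `π^♯ ∘ (𝒪_{X,s} → 𝒪_{X, π(q_j w)})`, it is compatible with the specialization maps of `X'`, and
the prime of the generisation `q_j p` (`p ≤ w`) in `𝒪_{X', q_j w}` is `p · (B_j)_w` (`primeOfSpecializes_eq_map`).
[cite: StacksProject, Tag 0804; Tag 0805; Tag 01J7] [cite: GortzWedhorn2020, Prop. 13.91]
-/

noncomputable section

open CategoryTheory CategoryTheory.Limits AlgebraicGeometry TopologicalSpace Topology IsLocalRing

namespace Summit.ResolutionOfSingularities.ResolutionOfSingularities.Theorems.SplitTower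

open Literature.AlgebraicGeometry.Resolution Scheme.IdealSheafData

universe u

/-! ## §C1  The stalk map of `Spec B → Spec 𝒪_{X,s} → X` at a point over a generisation of `s` -/

/-- **The structure map on stalks, over a generisation.** For `φ : 𝒪_{X,s} → B` and `𝔴 ∈ Spec B` whose image
`y` under `Spec B → Spec 𝒪_{X,s} → X` specialises to `s`, the stalk map at `𝔴` composed with `𝒪_{X,s} → 𝒪_{X,y}`
is `φ` followed by `B ≅ Γ(Spec B) → 𝒪_{Spec B, 𝔴}` (the case `y = s` is the tree's
`germ_ΓSpecIso_inv_apply_eq_stalkMap`). [cite: StacksProject, Tag 01J7] -/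
theorem germ_ΓSpecIso_inv_apply_eq_stalkMap_stalkSpecializes {Y : Scheme.{u}} (s : Y) {B : CommRingCat.{u}}
    (φ : Y.presheaf.stalk s ⟶ B) (w : Spec B) (H : (Spec.map φ ≫ Y.fromSpecStalk s) w ⤳ s)
    (a : Y.presheaf.stalk s) :
    (Spec B).presheaf.germ ⊤ w trivial ((Scheme.ΓSpecIso B).inv (φ a)) =
      (Spec.map φ ≫ Y.fromSpecStalk s).stalkMap w ((Y.presheaf.stalkSpecializes H) a) := by
  obtain ⟨U, hxU, f, rfl⟩ := Y.presheaf.exists_germ_eq a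
  rw [TopCat.Presheaf.germ_stalkSpecializes_apply, Scheme.Hom.germ_stalkMap_apply, Scheme.Hom.comp_app]
  erw [CommRingCat.comp_apply]
  erw [Scheme.fromSpecStalk_app hxU, CommRingCat.comp_apply, CommRingCat.comp_apply]
  have h2 := ConcreteCategory.congr_hom ((Spec.map φ).naturality
    (homOfLE (le_top : (Y.fromSpecStalk s) ⁻¹ᵁ U ≤ ⊤)).op)
    ((Scheme.ΓSpecIso (Y.presheaf.stalk s)).inv (Y.presheaf.germ U s hxU f))
  simp only [CommRingCat.comp_apply] at h2
  erw [h2]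
  erw [TopCat.Presheaf.germ_res_apply]
  have h3 := ConcreteCategory.congr_hom (Scheme.ΓSpecIso_inv_naturality φ) (Y.presheaf.germ U s hxU f)
  simp only [CommRingCat.comp_apply] at h3
  erw [← h3]
  rfl

/-- **A chart point computes the stalk map along a generisation.** If `q : Spec B → X'` is an isomorphism on
the local rings at `𝔴` and lies over `Spec φ` (`q ≫ π = Spec φ ≫ (Spec 𝒪_{X,s} → X)`), then
`(B → B_𝔴 ≅ 𝒪_{X', q 𝔴}) ∘ φ = π^♯_{q 𝔴} ∘ (𝒪_{X,s} → 𝒪_{X, π (q 𝔴)})`. [cite: StacksProject, Tag 0804] -/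
theorem inv_stalkMap_germ_eq {X' X : Scheme.{u}} (π : X' ⟶ X) (s : X) {B : CommRingCat.{u}}
    (φ : X.presheaf.stalk s ⟶ B) (q : Spec B ⟶ X') (w : Spec B) [IsIso (q.stalkMap w)]
    (hsq : q ≫ π = Spec.map φ ≫ X.fromSpecStalk s) (h : π (q w) ⤳ s) (a : X.presheaf.stalk s) :
    inv (q.stalkMap w) ((Spec B).presheaf.germ ⊤ w trivial ((Scheme.ΓSpecIso B).inv (φ a))) =
      (π.stalkMap (q w)) ((X.presheaf.stalkSpecializes h) a) := by
  have H : (Spec.map φ ≫ X.fromSpecStalk s) w ⤳ s := by rwa [← hsq, Scheme.Hom.comp_apply]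
  have hinv : ∀ t, inv (q.stalkMap w) (q.stalkMap w t) = t := fun t => by
    rw [← CommRingCat.comp_apply, IsIso.hom_inv_id, CommRingCat.id_apply]
  rw [germ_ΓSpecIso_inv_apply_eq_stalkMap_stalkSpecializes s φ w H a]
  have e2 := ConcreteCategory.congr_hom
    (Scheme.Hom.stalkMap_congr_hom (Spec.map φ ≫ X.fromSpecStalk s) (q ≫ π) hsq.symm w)
    ((X.presheaf.stalkSpecializes H) a)
  rw [CommRingCat.comp_apply] at e2
  have e3 : ∀ t, (q ≫ π).stalkMap w t = q.stalkMap w (π.stalkMap (q w) t) := fun t =>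
    ConcreteCategory.congr_hom (Scheme.Hom.stalkMap_comp q π w) t
  rw [e2, TopCat.Presheaf.stalkCongr_hom, TopCat.Presheaf.stalkSpecializes_comp_apply, e3, hinv]
  rfl

/-! ## §C2  The chart family -/

variable {X' X : Scheme.{u}} {π : X' ⟶ X} {J : X.IdealSheafData} {s : X} {k : ℕ}
  {c : Fin k → X.presheaf.stalk s}

/-- **A CHART FAMILY of `π` over `Spec 𝒪_{X,s}`** for generators `c` of the centre stalk: charts
`q_j : Spec B_j → X'` over `Spec B_j → Spec 𝒪_{X,s} → X`, isomorphisms on all local rings, covering every point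
`x'` with `π x' ⤳ s`, along which specializations lift within a chart.  DEFINITION (NEW object, support; an
instance exists for every blowing up, `ChartFamily.nonempty`). [cite: StacksProject, Tag 0804] -/
structure ChartFamily (π : X' ⟶ X) (s : X) {k : ℕ} (c : Fin k → X.presheaf.stalk s) where
  /-- the chart morphisms `q_j : Spec B_j → X'` -/
  q : (j : Fin k) → (Spec (.of (chartRing c j)) ⟶ X')
  /-- `q_j` lies over `Spec B_j → Spec 𝒪_{X,s} → X` -/
  fac : ∀ j, q j ≫ π = Spec.map (CommRingCat.ofHom (chartBase c j)) ≫ X.fromSpecStalk s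
  /-- `q_j` is an isomorphism on every local ring -/
  iso : ∀ j (w : Spec (.of (chartRing c j))), IsIso ((q j).stalkMap w)
  /-- the charts cover every point lying over a generisation of `s` -/
  cover : ∀ x' : X', π x' ⤳ s → ∃ j w, q j w = x'
  /-- specializations between chart points lift into the chart of the special point -/
  lift : ∀ j j' (p : Spec (.of (chartRing c j'))) (w : Spec (.of (chartRing c j))),
    q j' p ⤳ q j w → ∃ p₁ : Spec (.of (chartRing c j)), p₁ ⤳ w ∧ q j p₁ = q j' p

/-- **Every blowing up has a chart family over each `Spec 𝒪_{X,s}`** (blowing up commutes with the flat base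
change `Spec 𝒪_{X,s} → X`, is unique, `Proj` is covered by its standard charts, `X' ×_X Spec 𝒪_{X,s} → X'` is a
pro-open immersion: a topological embedding inducing isomorphisms on local rings).
[cite: StacksProject, Tag 0804; Tag 0805] -/
theorem ChartFamily.nonempty (hπ : IsBlowup π J) (s : X) {k : ℕ} (c : Fin k → X.presheaf.stalk s)
    (hc : Ideal.span (Set.range c) = stalkIdeal J s) : Nonempty (ChartFamily π s c) := by
  classical
  have hcj : ∀ j, c j ∈ Ideal.span (Set.range c) := fun j => Ideal.mem_span_range_self (f := c) (x := j)
  haveI : Flat (X.fromSpecStalk s) := flat_fromSpecStalk X s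
  have hP : IsBlowup (pullback.snd π (X.fromSpecStalk s))
      (affineBlowup.idealSheaf (Ideal.span (Set.range c))) := by
    have h := hπ.pullback_snd_of_flat (X.fromSpecStalk s)
    rwa [comap_fromSpecStalk_eq_affineBlowupIdealSheaf, ← hc] at h
  obtain ⟨e, he, -⟩ := (affineBlowup.isBlowup (Ideal.span (Set.range c))).unique hP
  have hopen : ∀ j, IsOpenImmersion (affineBlowup.chartι (c j) (hcj j) ≫ e.hom) := fun j => inferInstance
  refine ⟨⟨fun j => (affineBlowup.chartι (c j) (hcj j) ≫ e.hom) ≫ pullback.fst π (X.fromSpecStalk s),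
    fun j => ?_, fun j w => ?_, fun x' hx' => ?_, fun j j' p w hsp => ?_⟩⟩
  · rw [Category.assoc, pullback.condition, Category.assoc, reassoc_of% he, ← Category.assoc,
      affineBlowup.chartι_π (c j) (hcj j)]
  · have h1 := isIso_stalkMap_pullback_fst_fromSpecStalk π s ((affineBlowup.chartι (c j) (hcj j) ≫ e.hom) w)
    have h2 : IsIso ((affineBlowup.chartι (c j) (hcj j) ≫ e.hom).stalkMap w) := inferInstance
    rw [Scheme.Hom.stalkMap_comp]
    exact @IsIso.comp_isIso _ _ _ _ _ _ _ h1 h2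
  · obtain ⟨y, hy⟩ : ∃ y : Spec (X.presheaf.stalk s), X.fromSpecStalk s y = π x' := by
      have : π x' ∈ Set.range (X.fromSpecStalk s) := by rw [Scheme.range_fromSpecStalk]; exact hx'
      exact this
    obtain ⟨z, hz, -⟩ := Scheme.Pullback.exists_preimage_pullback (f := π) (g := X.fromSpecStalk s) x' y hy.symm
    obtain ⟨z₀, rfl⟩ : ∃ z₀, e.hom z₀ = z := ⟨e.inv z, by simp⟩
    have hz₀ : z₀ ∈ (⊤ : (affineBlowup (Ideal.span (Set.range c))).Opens) := trivial
    rw [← affineBlowup.iSup_chartOpen_eq_top c rfl] at hz₀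
    obtain ⟨j, hzj⟩ := Opens.mem_iSup.mp hz₀
    obtain ⟨w, -, rfl⟩ := hzj
    exact ⟨j, w, hz⟩
  · -- specializations lift: `X' ×_X Spec 𝒪_{X,s} → X'` is an embedding and the charts are open in it
    have hemb := (pullback.fst π (X.fromSpecStalk s)).isEmbedding
    have hsp' : (affineBlowup.chartι (c j') (hcj j') ≫ e.hom) p ⤳ (affineBlowup.chartι (c j) (hcj j) ≫ e.hom) w := by
      rw [Scheme.Hom.comp_apply, Scheme.Hom.comp_apply] at hsp
      exact hemb.isInducing.specializes_iff.mp hsp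
    have hmem : (affineBlowup.chartι (c j') (hcj j') ≫ e.hom) p ∈
        Set.range (affineBlowup.chartι (c j) (hcj j) ≫ e.hom) :=
      hsp'.mem_open (affineBlowup.chartι (c j) (hcj j) ≫ e.hom).isOpenEmbedding.isOpen_range ⟨w, rfl⟩
    obtain ⟨p₁, hp₁⟩ := hmem
    refine ⟨p₁, ?_, ?_⟩
    · rw [← hp₁] at hsp'
      exact (affineBlowup.chartι (c j) (hcj j) ≫ e.hom).isOpenEmbedding.isInducing.specializes_iff.mp hsp'
    · change ((affineBlowup.chartι (c j) (hcj j) ≫ e.hom) ≫ pullback.fst π (X.fromSpecStalk s)) p₁ =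
        ((affineBlowup.chartι (c j') (hcj j') ≫ e.hom) ≫ pullback.fst π (X.fromSpecStalk s)) p
      rw [Scheme.Hom.comp_apply, hp₁, ← Scheme.Hom.comp_apply]

/-! ## §C3  The dictionary at a chart point -/

namespace ChartFamily

variable (F : ChartFamily π s c)

/-- The image of a chart point: `π (q_j 𝔴)` is the generisation of `s` defined by the prime `𝔴 ∩ 𝒪_{X,s}`.
[cite: StacksProject, Tag 01J7] -/
theorem base_apply (j : Fin k) (w : Spec (.of (chartRing c j))) :
    π (F.q j w) = X.fromSpecStalk s (Spec.map (CommRingCat.ofHom (chartBase c j)) w) := by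
  conv_lhs => rw [← Scheme.Hom.comp_apply, F.fac j]
  rw [Scheme.Hom.comp_apply]

/-- Every chart point lies over a generisation of `s`. [cite: StacksProject, Tag 01J7] -/
theorem specializes (j : Fin k) (w : Spec (.of (chartRing c j))) : π (F.q j w) ⤳ s := by
  rw [F.base_apply]
  exact fromSpecStalk_specializes _

/-- The prime of the generisation `π (q_j 𝔴)` of `s` is `𝔴 ∩ 𝒪_{X,s}`. [cite: StacksProject, Tag 01J7] -/
theorem primeOfSpecializes_base (j : Fin k) (w : Spec (.of (chartRing c j))) :
    primeOfSpecializes (F.specializes j w) = w.asIdeal.comap (chartBase c j) := by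
  have key : ∀ (y : X) (p : Spec (X.presheaf.stalk s)), y = X.fromSpecStalk s p → ∀ h : y ⤳ s,
      primeOfSpecializes h = p.asIdeal := by
    rintro _ p rfl h
    exact primeOfSpecializes_fromSpecStalk p
  exact key _ _ (F.base_apply j w) (F.specializes j w)

/-- `π (q_j 𝔴) = η` (a generisation `η ⤳ s`) iff `𝔴 ∩ 𝒪_{X,s}` is the prime of `η`. [cite: StacksProject, Tag 01J7] -/
theorem base_eq_iff (j : Fin k) (w : Spec (.of (chartRing c j))) {η : X} (h : η ⤳ s) :
    π (F.q j w) = η ↔ w.asIdeal.comap (chartBase c j) = primeOfSpecializes h := by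
  constructor
  · intro e
    rw [← F.primeOfSpecializes_base j w]
    have key : ∀ (y : X) (h1 : y ⤳ s), y = η → primeOfSpecializes h1 = primeOfSpecializes h := by
      rintro _ h1 rfl; rfl
    exact key _ (F.specializes j w) e
  · intro e
    rw [F.base_apply, ← Literature.AlgebraicGeometry.Motives.fromSpecStalk_comap_maximalIdeal h]
    congr 1
    exact PrimeSpectrum.ext e

/-- `π (q_j 𝔴) = s` iff `𝔴` lies over the maximal ideal of `𝒪_{X,s}`. [cite: StacksProject, Tag 01J7] -/
theorem base_eq_self_iff (j : Fin k) (w : Spec (.of (chartRing c j))) :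
    π (F.q j w) = s ↔ w.asIdeal.comap (chartBase c j) = maximalIdeal (X.presheaf.stalk s) := by
  rw [F.base_eq_iff j w (specializes_refl s), primeOfSpecializes_refl]

/-- **The dictionary map `χ_𝔴 : B_j → (B_j)_𝔴 ≅ 𝒪_{X', q_j 𝔴}`** (`B_j ≅ Γ(Spec B_j) → 𝒪_{Spec B_j, 𝔴}`, then the
inverse of the stalk isomorphism of `q_j`).  DEFINITION (support). [cite: StacksProject, Tag 0804] -/
noncomputable def χ (j : Fin k) (w : Spec (.of (chartRing c j))) :
    chartRing c j →+* X'.presheaf.stalk (F.q j w) :=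
  haveI := F.iso j w
  ((Scheme.ΓSpecIso (.of (chartRing c j))).inv ≫
    (Spec (.of (chartRing c j))).presheaf.germ ⊤ w trivial ≫ inv ((F.q j).stalkMap w)).hom

/-- Unfolding `χ_𝔴`. [folklore] -/
theorem χ_apply (j : Fin k) (w : Spec (.of (chartRing c j))) (b : chartRing c j) :
    F.χ j w b = (@inv _ _ _ _ ((F.q j).stalkMap w) (F.iso j w))
      ((Spec (.of (chartRing c j))).presheaf.germ ⊤ w trivial
        ((Scheme.ΓSpecIso (.of (chartRing c j))).inv b)) := rfl

/-- **`χ_𝔴` presents `𝒪_{X', q_j 𝔴}` as the localization `(B_j)_𝔴`.** [cite: StacksProject, Tag 0804] -/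
theorem isLocalization (j : Fin k) (w : Spec (.of (chartRing c j))) :
    @IsLocalization.AtPrime _ _ (X'.presheaf.stalk (F.q j w)) _ (F.χ j w).toAlgebra w.asIdeal _ := by
  haveI := F.iso j w
  let τ : CommRingCat.of (chartRing c j) ⟶ (Spec (.of (chartRing c j))).presheaf.stalk w :=
    (Scheme.ΓSpecIso (.of (chartRing c j))).inv ≫ (Spec (.of (chartRing c j))).presheaf.germ ⊤ w trivial
  letI : Algebra (chartRing c j) (X'.presheaf.stalk (F.q j w)) := (F.χ j w).toAlgebra
  letI : Algebra (chartRing c j) ((Spec (.of (chartRing c j))).presheaf.stalk w) := τ.hom.toAlgebra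
  have hloc : IsLocalization.AtPrime ((Spec (.of (chartRing c j))).presheaf.stalk w) w.asIdeal :=
    StructureSheaf.IsLocalization.to_stalk (R := CommRingCat.of (chartRing c j)) w
  let ε : (Spec (.of (chartRing c j))).presheaf.stalk w ≃ₐ[chartRing c j] X'.presheaf.stalk (F.q j w) :=
    AlgEquiv.ofRingEquiv (f := ((asIso ((F.q j).stalkMap w)).symm).commRingCatIsoToRingEquiv) fun b => rfl
  exact IsLocalization.isLocalization_of_algEquiv w.asIdeal.primeCompl ε

/-- **`χ_𝔴` on `𝒪_{X,s}` is `π^♯` after the generisation map**: `χ_𝔴 (φ a) = π^♯_{q_j 𝔴} (a ↦ 𝒪_{X, π(q_j 𝔴)})`.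
[cite: StacksProject, Tag 0804] -/
theorem χ_base (j : Fin k) (w : Spec (.of (chartRing c j))) (a : X.presheaf.stalk s) :
    F.χ j w (chartBase c j a) =
      (π.stalkMap (F.q j w)).hom ((X.presheaf.stalkSpecializes (F.specializes j w)).hom a) := by
  haveI := F.iso j w
  exact inv_stalkMap_germ_eq π s (CommRingCat.ofHom (chartBase c j)) (F.q j) w (F.fac j) (F.specializes j w) a

/-- Specialization of germs of global sections on an affine scheme (an instance of Mathlib's
`germ_stalkSpecializes`, isolated so that unification stays cheap). [folklore] -/
theorem germ_top_stalkSpecializes {B : CommRingCat.{u}} {p w : Spec B} (h : p ⤳ w) (t : Γ(Spec B, ⊤)) :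
    (Spec B).presheaf.stalkSpecializes h ((Spec B).presheaf.germ ⊤ w trivial t) =
      (Spec B).presheaf.germ ⊤ p trivial t :=
  TopCat.Presheaf.germ_stalkSpecializes_apply _ _ _ _

set_option maxHeartbeats 400000 in -- WRITER NOTE (g16): pre-budgeted (elaboration exceeds 100k = half the tree default; ops-buildfix standing ask)
/-- **`χ` is compatible with the specialization maps of `X'`**: for chart points `p ⤳ 𝔴`,
`(𝒪_{X',q 𝔴} → 𝒪_{X',q p}) ∘ χ_𝔴 = χ_p`. [folklore] -/
theorem stalkSpecializes_χ (j : Fin k) {p w : Spec (.of (chartRing c j))} (h : p ⤳ w) (b : chartRing c j) :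
    (X'.presheaf.stalkSpecializes ((F.q j).base.hom.map_specializes h)).hom (F.χ j w b) = F.χ j p b := by
  haveI := F.iso j w
  haveI := F.iso j p
  have e1 : X'.presheaf.stalkSpecializes ((F.q j).base.hom.map_specializes h) =
      ((F.q j).stalkMap w ≫ (Spec (.of (chartRing c j))).presheaf.stalkSpecializes h) ≫
        inv ((F.q j).stalkMap p) := by
    rw [IsIso.eq_comp_inv]
    exact Scheme.Hom.stalkSpecializes_stalkMap (F.q j) p w h
  have hwinv : ∀ t, (F.q j).stalkMap w (inv ((F.q j).stalkMap w) t) = t := fun t => by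
    rw [← CommRingCat.comp_apply, IsIso.inv_hom_id, CommRingCat.id_apply]
  have e2 := ConcreteCategory.congr_hom e1 (F.χ j w b)
  simp only [CommRingCat.comp_apply] at e2
  rw [e2]
  have hχw : (F.q j).stalkMap w (F.χ j w b) =
      (Spec (.of (chartRing c j))).presheaf.germ ⊤ w trivial
        ((Scheme.ΓSpecIso (.of (chartRing c j))).inv b) := by
    rw [F.χ_apply]; exact hwinv _
  rw [hχw]
  have e3 := germ_top_stalkSpecializes h ((Scheme.ΓSpecIso (.of (chartRing c j))).inv b)
  exact (congrArg (inv ((F.q j).stalkMap p)).hom e3).trans (F.χ_apply j p b).symm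

set_option maxHeartbeats 400000 in -- WRITER NOTE (g16): pre-budgeted (elaboration exceeds 100k = half the tree default; ops-buildfix standing ask)
/-- **The prime of a generisation read in the chart**: for chart points `p ⤳ 𝔴`, the prime of `q_j p` in
`𝒪_{X', q_j 𝔴}` contracts to `p` along `χ_𝔴`. [cite: StacksProject, Tag 01J7] -/
theorem comap_χ_primeOfSpecializes (j : Fin k) {p w : Spec (.of (chartRing c j))} (h : p ⤳ w) :
    (primeOfSpecializes ((F.q j).base.hom.map_specializes h)).comap (F.χ j w) = p.asIdeal := by
  ext b
  letI := (F.χ j p).toAlgebra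
  haveI := F.isLocalization j p
  rw [Ideal.mem_comap]
  change (X'.presheaf.stalkSpecializes ((F.q j).base.hom.map_specializes h)).hom (F.χ j w b) ∈
    maximalIdeal _ ↔ _
  rw [F.stalkSpecializes_χ j h b]
  exact IsLocalization.AtPrime.to_map_mem_maximal_iff (X'.presheaf.stalk (F.q j p)) p.asIdeal b

set_option maxHeartbeats 400000 in -- WRITER NOTE (g16): pre-budgeted (elaboration exceeds 100k = half the tree default; ops-buildfix standing ask)
/-- **… and is the extension of `p`**: `𝔭_{q_j p} = p · 𝒪_{X', q_j 𝔴}` (primes of a localization are extended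
from their contractions). [cite: StacksProject, Tag 01J7] -/
theorem primeOfSpecializes_eq_map (j : Fin k) {p w : Spec (.of (chartRing c j))} (h : p ⤳ w) :
    primeOfSpecializes ((F.q j).base.hom.map_specializes h) = p.asIdeal.map (F.χ j w) := by
  letI := (F.χ j w).toAlgebra
  haveI := F.isLocalization j w
  rw [← F.comap_χ_primeOfSpecializes j h]
  have e := IsLocalization.map_under (M := w.asIdeal.primeCompl) (S := X'.presheaf.stalk (F.q j w))
    (primeOfSpecializes ((F.q j).base.hom.map_specializes h))
  rw [Ideal.under_def] at e
  exact e.symm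

/-- Chart points over `s` itself: `𝔴 ∩ 𝒪_{X,s} = 𝔪_s` when `π (q_j 𝔴) = s`. [cite: StacksProject, Tag 01J7] -/
theorem comap_eq_maximalIdeal (j : Fin k) {w : Spec (.of (chartRing c j))} (hw : π (F.q j w) = s) :
    w.asIdeal.comap (chartBase c j) = maximalIdeal (X.presheaf.stalk s) :=
  (F.base_eq_self_iff j w).mp hw

end ChartFamily

end Summit.ResolutionOfSingularities.ResolutionOfSingularities.Theorems.SplitTower

end
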